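import Summits.NavierStokesRegularity.NavierStokesRegularity.Theorems.PerpetualPumpAveragedTypeIBlowupChainCriticalTools
import Summits.NavierStokesRegularity.NavierStokesRegularity.Theorems.PerpetualPumpAveragedTypeIBlowupKernelDeriv
import Summits.NavierStokesRegularity.NavierStokesRegularity.Theorems.PerpetualPumpAveragedTypeIBlowupTodaLegal

/-!
# Crux `PerpetualPump.AveragedTypeIBlowup` (stmt-NavierStokesRegularity-1835), line `Sketch`:
# the stub `chainCriticalC1` — the critical Toda system with CONTINUOUS error functions

T. Tao, *Finite time blowup for an averaged three-dimensional Navier–Stokes equation*, J. Amer.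
Math. Soc. **29** (2016), 601–674 = arXiv:1402.0290v3, §4, p. 22 (4.14): pairing the wavelet
Duhamel formula with `ψ_{i,n}` gives the exact Volterra chain of the coefficients,
`Y_{i,n}(t) = A 1_{(i,n)=(i₀,n₀)} k_{i,n}(t) + ∫₀ᵗ k_{i,n}(t-s) quadTerm(Y)_{i,n}(s) ds`, with the mode heat
kernels `k_{i,n}(τ) = Re⟨e^{τΔ}ψ_{i,n}, ψ_{i,n}⟩`.

This file proves `stub_chainCriticalC1`, the companion of the registered stub `stub_chainCritical`
(file `…ChainCritical.lean`) that the Layer-2 phase lemmas of the line consume: they take CONTINUOUS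
error functions. Same hypotheses (thin wavelet data, radius `≤ r`, centres on `|ξ| = ρ₀ = 1 + ε₀/4`;
seeded Toda structure constants with coupling `D_c = 4π²(ρ₀² + r²)` and seed `ε̄ D_c`; a continuous
chain solution from the carrier datum `A` at scale `n₀`) and the same critical variables
`b_n = −(1+ε₀)^{n/2} Y₀,ₙ`, `w_n = (1+ε₀)^{n/2} Y₁,ₙ`, nonlinearities `G0, G1`, rates `R_n = D_c(1+ε₀)^{2n}`,
`η = 2ρ₀r/(ρ₀²+r²)` and kernel majorants `M0, M1` (the unused rate `θ` is dropped, and the seeded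
Toda structure constants are passed ONCE as a parameter `α` with its defining equation — instantiate
with `rfl` — so that the registered signature stays short); conclusion: on every `[0,T]`, `T < S`,
there are functions `db k`, `dw k` CONTINUOUS on `[0,T]` with `b_k' = db k`, `w_k' = dw k` on `(0,T)`
and `|db − R(−b + G0)| ≤ ηRM0`, `|dw − R(−w + G1)| ≤ ηRM1` there.

The derivative of `Y_{i,n}` is the EXPLICIT function `A1·k'(t) + Q̃(t) + ∫₀ᵗ k'(t−s)Q̃(s) ds`
(`Q̃` = the drive clamped to `[0,T]`; `chainCritical_hasDerivAt_explicit`,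
`chainCritical_continuous_explicit` of the tools file, from the Leibniz rule
`hasDerivAt_volterra_kernel`), continuous on `ℝ`; its memory error is that of `stub_chainODE`
(`chainCritical_explicit_estimate`), and the passage to critical variables is the scale-weight algebra
of `stub_chainCritical` (`stub_kernelDeriv`, `stub_kernel`, `stub_todaLegal`,
`chainCritical_weight_identities`). The abstract-kernel form is `chainCriticalC1_of_kernels`.

Nothing here closes the item (`--supports`); no statement of the route changes.

## References

* T. Tao, J. Amer. Math. Soc. 29 (2016), 601–674, arXiv:1402.0290v3, §4 p. 22 (4.14).
  [`Tao2016AveragedNS`]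
-/

noncomputable section

-- the summit namespace `…NavierStokesRegularity.NavierStokesRegularity…` is the tree convention
set_option linter.dupNamespace false

open MeasureTheory Set Filter Topology
open scoped ENNReal
open Literature.Analysis.FluidPDE Literature.Analysis.FluidPDE.Tao2016
open Literature.Analysis.FluidPDE.TaoCascade (quadTerm IsSymmetricCoeff IsCancellingCoeff)

namespace Summit.NavierStokesRegularity.NavierStokesRegularity.Theorems.PerpetualPumpAveragedTypeIBlowup

variable {ε₀ : ℝ}

/-! ### The critical system with continuous error functions -/

/-- **The critical system with CONTINUOUS explicit derivatives, abstract smooth kernels.** Under the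
hypotheses of `chainCritical_of_kernels`, the critical variables have the explicit derivatives
`db = −(1+ε₀)^{k/2}(A1·(−K₁) + Q̃₀ + ∫₀ᵗ(−K₁(t−s))Q̃₀(s)ds)`, `dw = (1+ε₀)^{k/2}(Q̃₁ + ∫₀ᵗ(−K₁(t−s))Q̃₁(s)ds)`
(`Q̃` the drive clamped to `[0,T]`), continuous on `[0,T]`, with the same memory-error bounds
`|db − R(−b + G0)| ≤ ηRM0`, `|dw − R(−w + G1)| ≤ ηRM1` on `(0,T)`. [cite: Tao2016AveragedNS, §4 p. 22 (4.14)] -/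
theorem chainCriticalC1_of_kernels (hε₀ : 0 < ε₀) {α : Fin 2 → Fin 2 → Fin 2 → ℤ × ℤ × ℤ → ℝ}
    {κ K K₁ : Fin 2 → ℤ → ℝ → ℝ} {Dlo Dhi R : ℤ → ℝ} {η q c εb : ℝ} {n₀ : ℤ} {A S : ℝ}
    {Y : Fin 2 → ℤ → ℝ → ℝ} {bv wv G0 G1 M0 M1 : ℤ → ℝ → ℝ}
    (hκ : ∀ i n τ, 0 ≤ τ → κ i n τ = K i n τ)
    (hK : ∀ i n τ, HasDerivAt (K i n) (-K₁ i n τ) τ) (hK₁ : ∀ i n, Continuous (K₁ i n))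
    (hK0 : ∀ i n, K i n 0 = 1)
    (hpinch : ∀ (i : Fin 2) (n : ℤ) (τ : ℝ), 0 ≤ τ →
      0 ≤ K i n τ ∧ Dlo n * K i n τ ≤ K₁ i n τ ∧ K₁ i n τ ≤ Dhi n * K i n τ)
    (hsum : ∀ n, Dlo n + Dhi n = 2 * R n) (hdiff : ∀ n, Dhi n - Dlo n = 2 * (η * R n))
    (hR : ∀ n, R n = c * (1 + ε₀) ^ (2 * n)) (hq : q = Real.sqrt (1 + ε₀))
    (hYc : ∀ i n, ContinuousOn (Y i n) (Ico 0 S))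
    (hchain : ∀ (i : Fin 2) (n : ℤ), ∀ t ∈ Ico 0 S,
      Y i n t = (if i = 0 ∧ n = n₀ then A else 0) * κ i n t +
        ∫ s in (0 : ℝ)..t, κ i n (t - s) * quadTerm ε₀ α Y i n s)
    (hQ0 : ∀ n t, quadTerm ε₀ α Y 0 n t =
      c * (1 + ε₀) ^ ((5 : ℝ) * (n : ℝ) / 2) * Y 1 n t ^ 2 -
        c * (1 + ε₀) ^ ((5 : ℝ) * ((n : ℝ) - 1) / 2) * Y 1 (n - 1) t ^ 2 -
        εb * c * (1 + ε₀) ^ ((5 : ℝ) * (n : ℝ) / 2) * (Y 0 n t * Y 1 n t))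
    (hQ1 : ∀ n t, quadTerm ε₀ α Y 1 n t =
      c * (1 + ε₀) ^ ((5 : ℝ) * (n : ℝ) / 2) * (Y 1 n t * (Y 0 (n + 1) t - Y 0 n t)) +
        εb * c * (1 + ε₀) ^ ((5 : ℝ) * (n : ℝ) / 2) * Y 0 n t ^ 2)
    (hbv : ∀ n t, bv n t = -((1 + ε₀) ^ ((n : ℝ) / 2) * Y 0 n t))
    (hwv : ∀ n t, wv n t = (1 + ε₀) ^ ((n : ℝ) / 2) * Y 1 n t)
    (hG0 : ∀ k t, G0 k t = (wv (k - 1) t) ^ 2 / q ^ 3 - (wv k t) ^ 2 - εb * bv k t * wv k t)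
    (hG1 : ∀ k t, G1 k t = wv k t * (bv k t - bv (k + 1) t / q) + εb * (bv k t) ^ 2)
    (hM0 : ∀ n t, M0 n t = (1 + ε₀) ^ ((n : ℝ) / 2) *
      ((if n = n₀ then |A| else 0) * K 0 n t +
        ∫ s in (0 : ℝ)..t, K 0 n (t - s) * |quadTerm ε₀ α Y 0 n s|))
    (hM1 : ∀ n t, M1 n t = (1 + ε₀) ^ ((n : ℝ) / 2) *
      (∫ s in (0 : ℝ)..t, K 1 n (t - s) * |quadTerm ε₀ α Y 1 n s|))
    {T : ℝ} (hT : 0 < T) (hTS : T < S) :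
    ∃ db dw : ℤ → ℝ → ℝ, ∀ k : ℤ, ContinuousOn (db k) (Icc 0 T) ∧ ContinuousOn (dw k) (Icc 0 T) ∧
      ∀ t ∈ Ioo 0 T, HasDerivAt (bv k) (db k t) t ∧
        |db k t - R k * (-(bv k t) + G0 k t)| ≤ η * R k * M0 k t ∧
        HasDerivAt (wv k) (dw k t) t ∧ |dw k t - R k * (-(wv k t) + G1 k t)| ≤ η * R k * M1 k t := by
  have hL : 0 < 1 + ε₀ := by linarith
  -- the chain with the smooth kernels
  have hchainK : ∀ (i : Fin 2) (n : ℤ), ∀ t ∈ Ico 0 S,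
      Y i n t = (if i = 0 ∧ n = n₀ then A else 0) * K i n t +
        ∫ s in (0 : ℝ)..t, K i n (t - s) * quadTerm ε₀ α Y i n s := by
    intro i n t ht
    rw [hchain i n t ht, hκ i n t ht.1]
    congr 1
    refine intervalIntegral.integral_congr fun s hs => ?_
    rw [uIcc_of_le ht.1] at hs
    simp only [hκ i n (t - s) (sub_nonneg.2 hs.2)]
  have hP : ∀ n : ℤ, 0 < (1 + ε₀) ^ ((n : ℝ) / 2) := fun n => Real.rpow_pos_of_pos hL _
  -- the key algebra
  have hkey0 : ∀ (n : ℤ) (t : ℝ),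
      -((1 + ε₀) ^ ((n : ℝ) / 2) * quadTerm ε₀ α Y 0 n t) = R n * G0 n t := by
    intro n t
    obtain ⟨h1, h2, -⟩ := chainCritical_weight_identities hL n
    simp only [hQ0, hG0, hwv, hbv, hR, hq]
    linear_combination (-c * Y 1 n t ^ 2 + εb * c * (Y 0 n t * Y 1 n t)) * h1 +
      c * Y 1 (n - 1) t ^ 2 * h2
  have hkey1 : ∀ (n : ℤ) (t : ℝ),
      (1 + ε₀) ^ ((n : ℝ) / 2) * quadTerm ε₀ α Y 1 n t = R n * G1 n t := by
    intro n t
    obtain ⟨h1, -, h3⟩ := chainCritical_weight_identities hL n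
    simp only [hQ1, hG1, hwv, hbv, hR, hq]
    linear_combination (-c * Y 1 n t * Y 0 n t + εb * c * Y 0 n t ^ 2) * h1 +
      c * Y 1 n t * Y 0 (n + 1) t * h3
  have ha0 : ∀ n : ℤ, |(if (0 : Fin 2) = 0 ∧ n = n₀ then A else 0)| = if n = n₀ then |A| else 0 := by
    intro n
    by_cases h : n = n₀ <;> simp [h]
  have ha1 : ∀ n : ℤ, (if (1 : Fin 2) = 0 ∧ n = n₀ then A else 0) = 0 := by
    intro n
    simp [show (1 : Fin 2) ≠ 0 by decide]
  refine ⟨fun k t => -(1 + ε₀) ^ ((k : ℝ) / 2) *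
      ((if (0 : Fin 2) = 0 ∧ k = n₀ then A else 0) * -K₁ 0 k t +
        (quadTerm ε₀ α Y 0 k (max 0 (min T t)) +
          ∫ s in (0 : ℝ)..t, -K₁ 0 k (t - s) * quadTerm ε₀ α Y 0 k (max 0 (min T s)))),
    fun k t => (1 + ε₀) ^ ((k : ℝ) / 2) *
      (quadTerm ε₀ α Y 1 k (max 0 (min T t)) +
        ∫ s in (0 : ℝ)..t, -K₁ 1 k (t - s) * quadTerm ε₀ α Y 1 k (max 0 (min T s))),
    fun k => ⟨?_, ?_, fun t ht => ⟨?_, ?_, ?_, ?_⟩⟩⟩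
  · exact (continuous_const.mul ((continuous_const.mul (hK₁ 0 k).neg).add
      (chainCritical_continuous_explicit hK₁ hYc 0 k hT.le hTS))).continuousOn
  · exact (continuous_const.mul (chainCritical_continuous_explicit hK₁ hYc 1 k hT.le hTS)).continuousOn
  · rw [show bv k = fun u => -(1 + ε₀) ^ ((k : ℝ) / 2) * Y 0 k u from
      funext fun u => by rw [hbv, neg_mul]]
    exact (chainCritical_hasDerivAt_explicit hK hK₁ hK0 hYc hchainK 0 k hTS ht).const_mul _
  · have hest := chainCritical_explicit_estimate hε₀ hK hK₁ hK0 hpinch hsum hdiff hYc hchainK 0 k hTS ht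
    rw [ha0] at hest
    have hkey : -(1 + ε₀) ^ ((k : ℝ) / 2) * quadTerm ε₀ α Y 0 k t = R k * G0 k t := by
      rw [neg_mul]
      exact hkey0 k t
    have h := chainCritical_abs_error_le hest hkey
    rw [abs_neg, abs_of_pos (hP k)] at h
    rw [hbv, hM0]
    simpa only [neg_mul] using h
  · rw [show wv k = fun u => (1 + ε₀) ^ ((k : ℝ) / 2) * Y 1 k u from funext (hwv k)]
    have hf := chainCritical_hasDerivAt_explicit hK hK₁ hK0 hYc hchainK 1 k hTS ht
    simp only [ha1, zero_mul, zero_add] at hf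
    exact hf.const_mul _
  · have hest := chainCritical_explicit_estimate hε₀ hK hK₁ hK0 hpinch hsum hdiff hYc hchainK 1 k hTS ht
    simp only [ha1, abs_zero, zero_mul, zero_add] at hest
    have h := chainCritical_abs_error_le hest (hkey1 k t)
    rw [abs_of_pos (hP k)] at h
    rw [hwv, hM1]
    exact h

/-- **Stub `chainCriticalC1`** (companion of `stub_chainCritical` for the phase lemmas, which take
CONTINUOUS error functions). Same hypotheses and critical variables (the seeded Toda structure constants
are the parameter `α` with its defining equation; instantiate with `rfl`); conclusion: on every `[0,T]`,
`T < S`, there are functions `db`, `dw`, continuous on `[0,T]`, with `b' = db`, `w' = dw` on `(0,T)` and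
`|db − R(−b + G0)| ≤ ηRM0`, `|dw − R(−w + G1)| ≤ ηRM1` — the derivative of `Y_{i,n}` is the explicit
continuous function `A1·k'(t) + Q(t) + ∫₀ᵗ k'(t−s)Q(s)ds` (`hasDerivAt_volterra_kernel`).
[cite: Tao2016AveragedNS, §4 p. 22 (4.14)] -/
theorem stub_chainCriticalC1 :
    ∀ {ε₀ : ℝ}, 0 < ε₀ → ε₀ ≤ 1 → ∀ (𝒟 : CascadeWaveletData ε₀ 2) (r : ℝ), 0 < r → r ≤ (1 + ε₀ / 4) / 2 →
      (∀ i, 𝒟.radius i ≤ r ∧ ‖𝒟.center i‖ = 1 + ε₀ / 4) →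
      ∀ (Dc εb : ℝ) (n₀ : ℤ) (A S : ℝ) (Y : Fin 2 → ℤ → ℝ → ℝ)
        (α : Fin 2 → Fin 2 → Fin 2 → ℤ × ℤ × ℤ → ℝ),
      α = (fun (i₁ i₂ i₃ : Fin 2) (μ : ℤ × ℤ × ℤ) =>
          if i₁ = 1 ∧ i₂ = 1 ∧ i₃ = 0 ∧ μ = (0, 0, 0) then Dc else
          if i₁ = 1 ∧ i₂ = 0 ∧ i₃ = 1 ∧ μ = (0, 0, 0) then -Dc / 2 else
          if i₁ = 0 ∧ i₂ = 1 ∧ i₃ = 1 ∧ μ = (0, 0, 0) then -Dc / 2 else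
          if i₁ = 1 ∧ i₂ = 0 ∧ i₃ = 1 ∧ μ = (0, 1, 0) then Dc / 2 else
          if i₁ = 0 ∧ i₂ = 1 ∧ i₃ = 1 ∧ μ = (1, 0, 0) then Dc / 2 else
          if i₁ = 1 ∧ i₂ = 1 ∧ i₃ = 0 ∧ μ = (0, 0, 1) then -Dc else
          if i₁ = 0 ∧ i₂ = 0 ∧ i₃ = 1 ∧ μ = (0, 0, 0) then εb * Dc else
          if i₁ = 0 ∧ i₂ = 1 ∧ i₃ = 0 ∧ μ = (0, 0, 0) then -(εb * Dc) / 2 else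
          if i₁ = 1 ∧ i₂ = 0 ∧ i₃ = 0 ∧ μ = (0, 0, 0) then -(εb * Dc) / 2 else 0) →
      Dc = 4 * Real.pi ^ 2 * ((1 + ε₀ / 4) ^ 2 + r ^ 2) → 0 < S →
      (∀ i n, ContinuousOn (Y i n) (Ico 0 S)) →
      (∀ i n t, n < n₀ → Y i n t = 0) →
      (∀ (i : Fin 2) (n : ℤ), ∀ t ∈ Ico 0 S,
        Y i n t = (if i = 0 ∧ n = n₀ then A else 0) *
            (pairing (heat t (cascadeWavelet ε₀ (𝒟.ψ i) n)) (cascadeWavelet ε₀ (𝒟.ψ i) n)).re +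
          ∫ s in (0 : ℝ)..t,
            (pairing (heat (t - s) (cascadeWavelet ε₀ (𝒟.ψ i) n)) (cascadeWavelet ε₀ (𝒟.ψ i) n)).re *
              quadTerm ε₀ α Y i n s) →
      let η : ℝ := 2 * (1 + ε₀ / 4) * r / ((1 + ε₀ / 4) ^ 2 + r ^ 2)
      let q : ℝ := Real.sqrt (1 + ε₀)
      let R : ℤ → ℝ := fun k => Dc * (1 + ε₀) ^ (2 * k)
      let K : Fin 2 → ℤ → ℝ → ℝ := fun i n τ => ∫ ξ, Real.exp (-(heatRate ξ * τ)) * modeWeight 𝒟 i n ξ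
      let bv : ℤ → ℝ → ℝ := fun n t => -((1 + ε₀) ^ ((n : ℝ) / 2) * Y 0 n t)
      let wv : ℤ → ℝ → ℝ := fun n t => (1 + ε₀) ^ ((n : ℝ) / 2) * Y 1 n t
      let G0 : ℤ → ℝ → ℝ := fun k t => (wv (k - 1) t) ^ 2 / q ^ 3 - (wv k t) ^ 2 - εb * bv k t * wv k t
      let G1 : ℤ → ℝ → ℝ := fun k t => wv k t * (bv k t - bv (k + 1) t / q) + εb * (bv k t) ^ 2
      let M0 : ℤ → ℝ → ℝ := fun n t => (1 + ε₀) ^ ((n : ℝ) / 2) *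
        ((if n = n₀ then |A| else 0) * K 0 n t +
          ∫ s in (0 : ℝ)..t, K 0 n (t - s) * |quadTerm ε₀ α Y 0 n s|)
      let M1 : ℤ → ℝ → ℝ := fun n t => (1 + ε₀) ^ ((n : ℝ) / 2) *
        (∫ s in (0 : ℝ)..t, K 1 n (t - s) * |quadTerm ε₀ α Y 1 n s|)
      ∀ T : ℝ, 0 < T → T < S →
        ∃ db dw : ℤ → ℝ → ℝ, ∀ k : ℤ, ContinuousOn (db k) (Icc 0 T) ∧ ContinuousOn (dw k) (Icc 0 T) ∧
          ∀ t ∈ Ioo 0 T, HasDerivAt (bv k) (db k t) t ∧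
            |db k t - R k * (-(bv k t) + G0 k t)| ≤ η * R k * M0 k t ∧
            HasDerivAt (wv k) (dw k t) t ∧ |dw k t - R k * (-(wv k t) + G1 k t)| ≤ η * R k * M1 k t := by
  intro ε₀ hε₀ hε₁ 𝒟 r hr hr2 hD Dc εb n₀ A S Y α hα hDc _ hYc _ hchain η q R K bv wv G0 G1 M0 M1 T hT hTS
  subst hα
  have hrρ : r < 1 + ε₀ / 4 := by linarith
  have hKD := fun i n => stub_kernelDeriv hε₀ hε₁ 𝒟 (1 + ε₀ / 4) r hr hrρ hD i n
  obtain ⟨-, -, hQ⟩ := stub_todaLegal Dc (εb * Dc)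
  have hρr : 0 < (1 + ε₀ / 4) ^ 2 + r ^ 2 := by positivity
  exact chainCriticalC1_of_kernels (η := η) (q := q) (R := R) (K := K) (bv := bv) (wv := wv)
    (G0 := G0) (G1 := G1) (M0 := M0) (M1 := M1) hε₀
    (κ := fun i n τ => (pairing (heat τ (cascadeWavelet ε₀ (𝒟.ψ i) n)) (cascadeWavelet ε₀ (𝒟.ψ i) n)).re)
    (K₁ := fun i n τ => ∫ ξ, heatRate ξ * Real.exp (-(heatRate ξ * τ)) * modeWeight 𝒟 i n ξ)
    (Dlo := fun n => 4 * Real.pi ^ 2 * (1 + ε₀ / 4 - r) ^ 2 * (1 + ε₀) ^ (2 * n))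
    (Dhi := fun n => 4 * Real.pi ^ 2 * (1 + ε₀ / 4 + r) ^ 2 * (1 + ε₀) ^ (2 * n))
    (fun i n τ hτ => (hKD i n).1 τ hτ) (fun i n τ => (hKD i n).2.1 τ) (fun i n => (hKD i n).2.2.1)
    (fun i n => ((hKD i n).1 0 le_rfl).symm.trans (stub_kernel hε₀ hε₁ 𝒟 i n).1)
    (fun i n τ hτ => (hKD i n).2.2.2 τ hτ)
    (fun n => by
      show 4 * Real.pi ^ 2 * (1 + ε₀ / 4 - r) ^ 2 * (1 + ε₀) ^ (2 * n) +
          4 * Real.pi ^ 2 * (1 + ε₀ / 4 + r) ^ 2 * (1 + ε₀) ^ (2 * n) = 2 * (Dc * (1 + ε₀) ^ (2 * n))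
      rw [hDc]; ring)
    (fun n => by
      show 4 * Real.pi ^ 2 * (1 + ε₀ / 4 + r) ^ 2 * (1 + ε₀) ^ (2 * n) -
          4 * Real.pi ^ 2 * (1 + ε₀ / 4 - r) ^ 2 * (1 + ε₀) ^ (2 * n) =
        2 * (2 * (1 + ε₀ / 4) * r / ((1 + ε₀ / 4) ^ 2 + r ^ 2) * (Dc * (1 + ε₀) ^ (2 * n)))
      rw [hDc]; field_simp; ring)
    (fun _ => rfl) rfl hYc hchain (fun n t => (hQ ε₀ Y n t).1) (fun n t => (hQ ε₀ Y n t).2)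
    (fun _ _ => rfl) (fun _ _ => rfl) (fun _ _ => rfl) (fun _ _ => rfl) (fun _ _ => rfl)
    (fun _ _ => rfl) hT hTS

end Summit.NavierStokesRegularity.NavierStokesRegularity.Theorems.PerpetualPumpAveragedTypeIBlowup

end
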